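import Summits.BirchSwinnertonDyer.BirchSwinnertonDyer.Theses.QuadraticBranchSignedControl
import Literature.NumberTheory.EllipticCurves.IwasawaAlgebraInvolution
import HarnessLib

/-!
# Closer for the gen-2 split glue of K8 crux 20445 (`PlusKatoDivisibilityBranchOnto`, literal (RK⁺)-onto):
# `PlusKatoDivisibilityBranchOntoOfIotaOfInvolInvariant` (item stmt-BirchSwinnertonDyer-26770)

STAGED by bsd-potss-plan g27 (kit `plan/rekey-20445-g27/Closer_K8_…lean`, certified shape `ResplitSim2_K8.lean` `glue2_provable`,
farm rc 0 / 0 sorry), landed by seat `bsd-potss-k8q-c2x` g10 (prover) with the binder line adapted to edit B″ (child 1 is the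
IMPLICATION `h12 → hZ′ → Q73′ → ∀ rows …IotaAt`, so it is fed the three alias hypotheses, which unfold definitionally).
HONEST FRAMING: THEOREMS ONLY; closes the GLUE item (children ⟹ parent), i.e. records that the literal item 20445 follows from
its gen-2 children; it proves neither Kato's/Kobayashi's theorems nor Kim's (child 2 `PlusSignedDualsInvolInvariant` — B. D. Kim,
MRL 15 (2008) Thm 3.11, the algebraic functional equation of the signed duals — stays a displayed hypothesis of the glue); BSD is
proved for no curve; nothing is booked.

Mathematics: the `ι`-form (child 1 at children 3–5, `…Additive.QuadraticBranchPlusKatoDivisibilityIotaAt`) bounds `Char X⁺(V/ℚ_∞) ·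
(ι Lη)` inside `Char X⁺(V′/F_∞)`; applying the ring endomorphism `ι = IwasawaAlgebra.invol p` (`ι ∘ ι = id`, `ι(pⁿ) = pⁿ`) to both
inclusions and using `ι(Char X⁺(V/ℚ_∞)) = Char X⁺(V/ℚ_∞)`, `ι(Char X⁺(V′/F_∞)) = Char X⁺(V′/F_∞)` (child 2) gives the literal
(RK⁺)-onto statement.

References: [KimBD2008MRL] Thm. 3.11 (p. 93), eq. (1) (p. 83); [Kobayashi2003] Thm. 4.1 (p. 8); [Kato2004Asterisque] Thm. 13.4
(p. 226); [Greenberg1989] pp. 101–102.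
-/

noncomputable section

-- justification: the `Summit.BirchSwinnertonDyer.BirchSwinnertonDyer.…` path repeats a component (route-file convention)
set_option linter.dupNamespace false

namespace Summit.BirchSwinnertonDyer.BirchSwinnertonDyer.Theorems

open Summit.BirchSwinnertonDyer.BirchSwinnertonDyer.Theses.QuadraticBranchSignedControl
open Literature.NumberTheory.EllipticCurves

namespace KatoSideIotaGlue

/-- Transport of `A * (B * span{ι L}) ≤ C` under `ι`, given `ι(A) = A`, `ι(B) = B`, `ι(C) = C`. [folklore] -/
theorem map_invol_le_aux (p : ℕ) [Fact p.Prime] {A B C : Ideal (IwasawaAlgebra p)} {L : IwasawaAlgebra p}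
    (hA : A.map (IwasawaAlgebra.invol p) = A) (hB : B.map (IwasawaAlgebra.invol p) = B)
    (hC : C.map (IwasawaAlgebra.invol p) = C)
    (h : A * (B * Ideal.span {IwasawaAlgebra.invol p L}) ≤ C) : A * (B * Ideal.span {L}) ≤ C := by
  have h' := Ideal.map_mono (f := IwasawaAlgebra.invol p) h
  rw [Ideal.map_mul, Ideal.map_mul, hA, hB, hC, Ideal.map_span, Set.image_singleton,
    IwasawaAlgebra.invol_invol] at h'
  exact h'

/-- `ι (pⁿ) = (pⁿ)` as ideals of `Λ`. [folklore] -/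
theorem span_pow_p_map_invol (p : ℕ) [Fact p.Prime] (n : ℕ) :
    (Ideal.span {(p : IwasawaAlgebra p) ^ n} : Ideal (IwasawaAlgebra p)).map (IwasawaAlgebra.invol p) =
      Ideal.span {(p : IwasawaAlgebra p) ^ n} := by
  rw [Ideal.map_span, Set.image_singleton, map_pow, map_natCast]

end KatoSideIotaGlue

open KatoSideIotaGlue in
/-- **Closes the gen-2 split glue of K8 item 20445**: `PlusKatoDivisibilityBranchOntoIotaOfNamedInputs → PlusSignedDualsInvolInvariant →
PublishedInputKobThm12OntoIota → PublishedInputKobZetaEtaContraOnto → PublishedInputKatoThm134ContraOnto → PlusKatoDivisibilityBranchOnto`: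
feed the three alias hypotheses into child 1 to get the `ι`-form (RK⁺)^ι row by row, then transport both inclusions by
`ι = IwasawaAlgebra.invol p` using the `ι`-invariance of the two signed characteristic ideals (child 2) and `ι(pⁿ) = pⁿ`.
[cite: KimBD2008MRL, Thm. 3.11 (p. 93) and eq. (1) (p. 83) — the algebraic functional equation (a) = (a^ι)]
[cite: Kobayashi2003, Thm. 4.1 (p. 8)] [cite: Kato2004Asterisque, Thm. 13.4 (p. 226)] -/
theorem plusKatoDivisibilityBranchOntoOfIotaOfInvolInvariant_proof :
    PlusKatoDivisibilityBranchOntoOfIotaOfInvolInvariant := by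
  intro hI hS h12 hZ hQ V _ _ p _ h5 hg ha hs
  have HI := hI h12 hZ hQ V p h5 hg ha hs
  intro F _ _ V' _ κ γ κF γF N _ f hp2 hg' ha' hF hθ hC hκ hγ hcv hκF hγF hζ hnew ϖ hϖ Lη hL D DF
  obtain ⟨hfin, htor, ⟨n, hn⟩, honto⟩ :=
    HI F V' hp2 hg' ha' hF hθ hC hκ hγ hcv hκF hγF hζ hnew ϖ hϖ Lη hL D DF
  obtain ⟨hD, hDF⟩ := hS V p h5 hg ha F V' κ γ κF γF hF hθ hC hκ hγ hκF hγF D DF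
  refine ⟨hfin, htor, ⟨n, ?_⟩, fun hs' ↦ ?_⟩
  · exact map_invol_le_aux p (span_pow_p_map_invol p n) hD hDF hn
  · have h1 : (⊤ : Ideal (IwasawaAlgebra p)) * (D.charIdeal * Ideal.span {IwasawaAlgebra.invol p Lη}) ≤
        DF.charIdeal := by simpa using honto hs'
    have h2 := map_invol_le_aux p (by simp [Ideal.map_top]) hD hDF h1
    simpa using h2

end Summit.BirchSwinnertonDyer.BirchSwinnertonDyer.Theorems

end
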